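import Mathlib
import Summits.Ventures.PercRepro2.PMK5Deg3Kernel
import Summits.Ventures.PercRepro2.PMK5Deg4Kernel
import Summits.Ventures.PercRepro2.Deg4Conn
import Summits.Ventures.PercRepro2.Deg4Typed
import Summits.Ventures.PercRepro2.PMK5Deg4CertOA1A2U
import Summits.Ventures.PercRepro2.PMK5Deg4CertOA1A2B
import Summits.Ventures.PercRepro2.PMK5Deg4CertOA1UB
import Summits.Ventures.PercRepro2.PMK5Deg4CertOA2UB
import Summits.Ventures.PercRepro2.PMK5Deg4CertA1A2UB

/-!
# THEOREM 29 — THE WHOLE DEGREE-4 FAMILY: ROW 2′TRI AND (HCOV) ON `K₅ + {a₃x, a₃y, a₃z, a₃w}` FOR ALL FIVE ATTACHMENT QUADRUPLES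
(blind cell PercRepro2, mine-2 g29; the quadruple `(0, 1, 2, 4)` by mine-2 g28)

The five quadruples' certificates (`PMK5Deg4Cert*.lean`: `608` kernel-certified table literals and `1024` five-digit
slice certificates each) and the parametrised bridge `Deg4Typed.HCov_deg4` give, for every quadruple `x < y < z < w`
of vertices of the five-vertex base `K₅(o, a₁, a₂, u, b)` and the mark `a₃` joined to all four:
**`typedBases_all`** — row 2′TRI (`CovForm.TypedBases (ends14 x y z w) 0 1 2 5 4`) — and **`HCov_deg4_all`** —
(HCOV) for every probability vector `p : Fin 14 → R`.  With Theorems 14 / 16 / 27 / 28 this closes (HCOV) in the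
kernel on every six-vertex graph in which the five marks sit on a five-vertex base and the sixth vertex `a₃`
has degree `≤ 4` into it — i.e. on every six-vertex marked graph that misses at least one edge at `a₃`
(missing edges at weight `0`); only `K₆` itself (`a₃` of degree `5`) is outside.  Standard axioms only.
-/

namespace Summit.Ventures.PercRepro2

namespace Deg4

variable {R : Type*} [Field R] [LinearOrder R] [IsStrictOrderedRing R]

/-- **THEOREM 29 (typed form): row 2′TRI on every `K₅ + {a₃x, a₃y, a₃z, a₃w}`, `x < y < z < w`.** -/
theorem typedBases_all (x y z w : Fin 5) (hxy : x < y) (hyz : y < z) (hzw : z < w) :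
    CovForm.TypedBases (R := R) (ends14 x y z w) 0 1 2 5 4 := by
  fin_cases x <;> fin_cases y <;> fin_cases z <;> fin_cases w <;>
    first | exact absurd hxy (by decide) | exact absurd hyz (by decide) | exact absurd hzw (by decide) | skip
  · exact typedBases_oa1a2u
  · exact typedBases_oa1a2b
  · exact typedBases_oa1ub
  · exact typedBases_oa2ub
  · exact typedBases_a1a2ub

/-- **THEOREM 29: (HCOV) on every `K₅ + {a₃x, a₃y, a₃z, a₃w}`, `x < y < z < w`, for every weight vector.** -/
theorem HCov_deg4_all (x y z w : Fin 5) (hxy : x < y) (hyz : y < z) (hzw : z < w) (p : Fin 14 → R)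
    (hp : IsProbVec p) : CovForm.HCov p (ends14 x y z w) 0 1 2 5 4 := by
  fin_cases x <;> fin_cases y <;> fin_cases z <;> fin_cases w <;>
    first | exact absurd hxy (by decide) | exact absurd hyz (by decide) | exact absurd hzw (by decide) | skip
  · exact HCov_deg4_oa1a2u p hp
  · exact HCov_deg4_oa1a2b p hp
  · exact HCov_deg4_oa1ub p hp
  · exact HCov_deg4_oa2ub p hp
  · exact HCov_deg4_a1a2ub p hp

end Deg4

end Summit.Ventures.PercRepro2
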